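import Mathlib
import Summits.Ventures.PercRepro2.SwOutShadowMultiRootDefs
import Summits.Ventures.PercRepro2.SwOutMultiRootEBase

/-!
# The canonical units and decorations of a side point (blind cell PercRepro2, night-4 g35,
2026-08-29; proofs/NIGHT4-G35.md §4)

At a side point `ζ` with roots `R` (the non-escaping junctions with `h`), the UNIT of a vertex of the
red part of the extended hull is its cluster in the configuration `unitConfigB` — the blue edges
not at `l` together with every edge inside `extHullR ∖ R` (so that a unit contains whole arms and
the blue components of `V ∖ {l}` they meet); the unit of a vertex of the blue part is its cluster in
`unitConfigR` (red edges not at `l`).  The finite family `unitsR` = the units reached by a root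
edge; the ARM PART of a unit is its intersection with the extended hull, its DECORATION the rest;
`baseDeco` flips the blue units (arms with decorations) and makes every root–root edge red;
`omegaDeco` is the cube point of the side point (a unit is `true` iff its arm part is not in the
blue part, a root–root edge carries its colour).  Census: mining/night-4/g35/shadow12.py — on the
frontier every such unit is attached to `l` and the decorated cubes are exact (design 10 = 12).
-/

namespace Summit.Ventures.PercRepro2

namespace LocRows

open Hull

variable {V : Type*} {E : Type*}

open scoped Classical

variable {ends : E → Sym2 V}

section Defs

variable (ends) (R : Set V) (l : V) (ζ : Config E)

/-- The configuration of the red units: the blue edges not at `l`, and every edge inside the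
extended hull without the roots. -/
noncomputable def unitConfigB : Config E :=
  fun e => (blue ζ e && decide (e ∉ touches ends {l})) || armConfigR ends R ζ e

/-- The configuration of the blue units: the red edges not at `l`, and every edge inside the
extended hull without the roots. -/
noncomputable def unitConfigR : Config E :=
  fun e => (ζ e && decide (e ∉ touches ends {l})) || armConfigR ends R ζ e

/-- The unit of a vertex: its cluster in the configuration of its part. -/
noncomputable def unitOf (x : V) : Set V :=
  if x ∈ redPartR ends R ζ then cluster ends (unitConfigB ends R l ζ) x
  else cluster ends (unitConfigR ends R l ζ) x

/-- The unit reached by a root edge: the unit of its non-root end. -/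
noncomputable def unitOfEdge (e : E) : Set V :=
  {x | ∃ y ∈ ends e, y ∉ R ∧ x ∈ unitOf ends R l ζ y}

/-- The finite family of units (the units reached by a root edge). -/
noncomputable def unitsR [Fintype E] [DecidableEq E] : Finset (Set V) :=
  (rootEdgesR ends R).image (unitOfEdge ends R l ζ)

/-- The arm part of a unit: its vertices in the extended hull. -/
def unitArm (u : Set V) : Set V := u ∩ extHullR ends R ζ

/-- The decoration of a unit: its vertices outside the extended hull. -/
def unitDeco (u : Set V) : Set V := u \ extHullR ends R ζ

/-- The blue units: the units of the vertices of the blue part. -/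
def blueUnits : Set V := {x | ∃ y ∈ bluePartR ends R ζ, x ∈ unitOf ends R l ζ y}

/-- The decorated base of a side point: the blue units flipped, every root–root edge red. -/
noncomputable def baseDeco [Fintype E] [DecidableEq E] : Config E :=
  fun e => if e ∈ rrEdges ends R then true else flip ends (blueUnits ends R l ζ) ζ e

/-- The cube point of a side point: a unit is `true` iff its arm part is not in the blue part, a
root–root edge carries its colour. -/
noncomputable def omegaDeco [Fintype E] [DecidableEq E] :
    Config (↥(unitsR ends R l ζ) ⊕ ↥(rrEdges ends R)) :=
  Sum.elim (fun u => decide (¬ unitArm ends R ζ u.1 ⊆ bluePartR ends R ζ)) fun e => ζ e.1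

end Defs

section Basic

variable {R : Set V} {l : V} {ζ : Config E}

/-- The base on a root–root edge. -/
lemma baseDeco_apply_of_mem [Fintype E] [DecidableEq E] {e : E} (he : e ∈ rrEdges ends R) :
    baseDeco ends R l ζ e = true := by
  simp only [baseDeco, if_pos he]

/-- The base off the root–root edges. -/
lemma baseDeco_apply_of_notMem [Fintype E] [DecidableEq E] {e : E} (he : e ∉ rrEdges ends R) :
    baseDeco ends R l ζ e = flip ends (blueUnits ends R l ζ) ζ e := by
  simp only [baseDeco, if_neg he]

/-- An edge of the red-unit configuration is blue and not at `l`, or lies inside the extended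
hull without the roots. -/
lemma unitConfigB_eq_true_iff {e : E} :
    unitConfigB ends R l ζ e = true ↔
      (ζ e = false ∧ e ∉ touches ends {l}) ∨ e ∈ within ends (extHullR ends R ζ \ R) := by
  simp [unitConfigB, armConfigR, blue]

/-- An edge of the blue-unit configuration is red and not at `l`, or lies inside the extended
hull without the roots. -/
lemma unitConfigR_eq_true_iff {e : E} :
    unitConfigR ends R l ζ e = true ↔
      (ζ e = true ∧ e ∉ touches ends {l}) ∨ e ∈ within ends (extHullR ends R ζ \ R) := by
  simp [unitConfigR, armConfigR]

/-- The arm configuration lies below the red-unit configuration. -/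
lemma armConfigR_le_unitConfigB : armConfigR ends R ζ ≤ unitConfigB ends R l ζ := by
  intro e
  by_cases he : armConfigR ends R ζ e = true
  · rw [he]
    have : unitConfigB ends R l ζ e = true := by
      simp only [unitConfigB, he, Bool.or_true]
    rw [this]
  · simp only [Bool.not_eq_true] at he
    rw [he]; exact Bool.false_le _

/-- The arm configuration lies below the blue-unit configuration. -/
lemma armConfigR_le_unitConfigR : armConfigR ends R ζ ≤ unitConfigR ends R l ζ := by
  intro e
  by_cases he : armConfigR ends R ζ e = true
  · rw [he]
    have : unitConfigR ends R l ζ e = true := by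
      simp only [unitConfigR, he, Bool.or_true]
    rw [this]
  · simp only [Bool.not_eq_true] at he
    rw [he]; exact Bool.false_le _

/-- The arm of a vertex lies in its unit. -/
lemma armR_subset_unitOf (x : V) : armR ends R ζ x ⊆ unitOf ends R l ζ x := by
  unfold unitOf
  split_ifs
  · exact cluster_mono armConfigR_le_unitConfigB x
  · exact cluster_mono armConfigR_le_unitConfigR x

/-- A vertex lies in its unit. -/
lemma mem_unitOf_self (x : V) : x ∈ unitOf ends R l ζ x :=
  armR_subset_unitOf x (mem_armR_self x)

/-- `l` is in no unit (no edge of a unit configuration is at `l`, and `l` is not in the hull). -/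
lemma l_notMem_unitOf (hl : l ∉ extHullR ends R ζ) {x : V} (hx : x ≠ l) :
    l ∉ unitOf ends R l ζ x := by
  have key : ∀ ρ : Config E, (∀ e, ρ e = true → e ∉ touches ends {l}) →
      l ∉ cluster ends ρ x := by
    intro ρ hρ hl'
    have : l ∈ {v | v ≠ l} := mem_of_conn_of_closed (ends := ends) (ω := ρ) (S := {v | v ≠ l})
      (fun a ha b hab => by
        obtain ⟨-, e, he, hab'⟩ := exists_edge_of_adj hab
        intro hb
        rw [hb] at hab'
        exact hρ e he ⟨l, Set.mem_singleton l, a, by rw [hab']; exact Sym2.eq_swap⟩) hx hl'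
    exact this rfl
  unfold unitOf
  split_ifs
  · refine key _ fun e he => ?_
    rcases unitConfigB_eq_true_iff.1 he with ⟨-, h'⟩ | ⟨a, ha, b, hb, hab⟩
    · exact h'
    · rintro ⟨z, hz, w, hzw⟩
      rw [Set.mem_singleton_iff] at hz
      rw [hz, hab, Sym2.eq_iff] at hzw
      rcases hzw with ⟨h1, -⟩ | ⟨-, h2⟩
      · rw [h1] at ha; exact hl ha.1
      · rw [h2] at hb; exact hl hb.1
  · refine key _ fun e he => ?_
    rcases unitConfigR_eq_true_iff.1 he with ⟨-, h'⟩ | ⟨a, ha, b, hb, hab⟩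
    · exact h'
    · rintro ⟨z, hz, w, hzw⟩
      rw [Set.mem_singleton_iff] at hz
      rw [hz, hab, Sym2.eq_iff] at hzw
      rcases hzw with ⟨h1, -⟩ | ⟨-, h2⟩
      · rw [h1] at ha; exact hl ha.1
      · rw [h2] at hb; exact hl hb.1

/-- The unit reached by a root edge is the unit of its non-root end. -/
lemma unitOfEdge_eq {e : E} {r y : V} (hr : r ∈ R) (hry : ends e = s(r, y)) (hy : y ∉ R) :
    unitOfEdge ends R l ζ e = unitOf ends R l ζ y := by
  ext x
  simp only [unitOfEdge, Set.mem_setOf_eq]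
  constructor
  · rintro ⟨y', hy', hy'R, hx⟩
    rw [hry, Sym2.mem_iff] at hy'
    rcases hy' with rfl | rfl
    · exact absurd hr hy'R
    · exact hx
  · intro hx
    exact ⟨y, by rw [hry]; exact Sym2.mem_mk_right r y, hy, hx⟩

/-- The unit of the non-root end of a root edge is one of the units. -/
lemma unitOf_mem_unitsR [Fintype E] [DecidableEq E] {e : E} {r y : V} (hr : r ∈ R)
    (hry : ends e = s(r, y)) (hy : y ∉ R) : unitOf ends R l ζ y ∈ unitsR ends R l ζ := by
  rw [← unitOfEdge_eq hr hry hy]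
  exact Finset.mem_image_of_mem _ (by
    simp only [rootEdgesR, Finset.mem_filter, Finset.mem_univ, true_and]
    exact ⟨r, hr, y, hry, hy⟩)

/-- Every unit of the family is the unit of a non-root vertex adjacent to a root. -/
lemma exists_of_mem_unitsR [Fintype E] [DecidableEq E] {u : Set V} (hu : u ∈ unitsR ends R l ζ) :
    ∃ y, (∃ e r, r ∈ R ∧ ends e = s(r, y)) ∧ y ∉ R ∧ u = unitOf ends R l ζ y := by
  obtain ⟨e, he, rfl⟩ := Finset.mem_image.1 hu
  simp only [rootEdgesR, Finset.mem_filter, Finset.mem_univ, true_and] at he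
  obtain ⟨r, hr, y, hry, hyR⟩ := he
  exact ⟨y, ⟨e, r, hr, hry⟩, hyR, unitOfEdge_eq hr hry hyR⟩

/-- Membership in the arm part of a unit. -/
lemma mem_unitArm {u : Set V} {x : V} :
    x ∈ unitArm ends R ζ u ↔ x ∈ u ∧ x ∈ extHullR ends R ζ := Iff.rfl

/-- Membership in the decoration of a unit. -/
lemma mem_unitDeco {u : Set V} {x : V} :
    x ∈ unitDeco ends R ζ u ↔ x ∈ u ∧ x ∉ extHullR ends R ζ := Iff.rfl

/-- A unit is its arm part with its decoration. -/
lemma unitArm_union_unitDeco (u : Set V) :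
    unitArm ends R ζ u ∪ unitDeco ends R ζ u = u := by
  ext x
  simp only [unitArm, unitDeco, Set.mem_union, Set.mem_inter_iff, Set.mem_sdiff]
  tauto

end Basic

end LocRows

end Summit.Ventures.PercRepro2
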